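import Literature.AlgebraicGeometry.HodgeTheory.WeilClassesFieldRealMultiplicationMatricesDecomposable
import Literature.AlgebraicGeometry.HodgeTheory.WeilClassesFieldDecomposableOfMatrixUnits
import HarnessLib

/-!
# Moonen–Zarhin's Criterion (2), THE TYPE-2 ROW ON POWERS WITH A REAL-MULTIPLICATION CENTRE: on `A^{n+1}` with the
# product polarization, every subfield `F ⊆ M_{n+1}(ℚ(ψ)⟨α, β⟩)` — `ψ` Rosati-symmetric with irreducible minimal
# polynomial, `α, β` a Rosati-symmetric anticommuting pair with scalar squares commuting with `ψ` — has decomposable,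
# hence algebraic, Weil classes; with the abstract mechanism «a `Q_D`-orthogonal Morita datum commuting with a
# Rosati-symmetric operator of simple spectrum» (Moonen–Zarhin 1998 §1; Milne 1999 §1)

Layer `Literature/AlgebraicGeometry/HodgeTheory`; THEOREMS ONLY — no definition, no named fact, no `sorry` (D-0026, net
debt 0).  The second INSTANCE of the seat's multi-block Morita mechanism (`WeilClassesFieldDecomposableOfMatrixBlocks`),
after the type-1 row `WeilClassesFieldRealMultiplicationMatricesDecomposable`, together with the mechanism abstracted.

## The print

B. J. J. Moonen, Yu. G. Zarhin, *Weil classes on abelian varieties*, J. reine angew. Math. 496 (1998) 83–92 =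
arXiv:alg-geom/9612017 [MoonenZarhin1998WeilClasses] (held text `paper:arxiv-alg-geom_9612017`), §1 Criterion (2)
(chunk p0003 L46–L58) and its proof (L82–L90): for `X ∼ Y^m` with `Y` of TYPE 2 (`End⁰(Y) = D` a quaternion algebra
over a totally real field `E₀ = E`, `B = M_m(D) = End⁰(X)`, Table 1), EVERY subfield `F ⊆ End⁰(X)` has `W_F` consisting
of decomposable Hodge classes: «First assume that `X` is either of type 1, 2 … Conversely, suppose that `F ⊆ B`, so that
`G_div(X) ⊆ Gl_F(V_X)`.  In the cases we are considering, the group `G_div(X)` is connected and semi-simple, so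
`G_div(X) ⊆ Sl_F(V_X)`, hence `G_div(X)` acts trivially on `W_F`.»  The blocks (chunk p0002 L104–L118): «`Δ ⊗ ℂ =
∏_{τ ∈ Σ_{E₀}} Δ_ℂ^{(τ)}` … for Type 2: `Δ_ℂ^{(τ)} ≅ M_{2m}(ℂ)` with an orthogonal involution».
J. S. Milne, *Lefschetz classes on abelian varieties*, Duke Math. J. 96 (1999) [Milne1999LefschetzClasses], §1 p. 643:
«the involution `D` defines on `C(A)` is the restriction of the product of the involutions defined by the `Dᵢ`».

## What is proved (on the carriers `H¹(X(ℂ); ℂ)`; `D_X = Σ πᵢ^* h` the product class on `X = A^{n+1}`)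

§1 **`weilClassesField_le_divisorClassesSpan_of_moritaData_of_symmetric`** (any complex abelian variety `X`, `D ∈ B¹ ⊗ ℂ`
with `Q_D` non-degenerate): a `Q_D`-orthogonal Morita datum `(x, y, p)` over a finite `ι` inside `B ⊗ ℂ` (`yᵢ xⱼ =
δᵢⱼ p`, `Σ xᵢ yᵢ = 1`, `xᵢ† = yᵢ`), a Rosati-symmetric `T ∈ S_D ⊗ ℂ` commuting with it and killed by the nodal
polynomial of a finite `s ⊂ ℂ`, and `φ^* ∈ ℂ⟨T, x_a y_b⟩` (`P(φ) = 0`, `deg P · 2m = 2 dim X`) give `W_F ⊗ ℂ ≤ 𝒟ᵐ ⊗ ℂ`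
— blocks `(P_z xᵢ, P_z yᵢ, P_z p)_z`, `P_z = ℓ_z(T)` the Lagrange projectors.
§2 Diagonals `(f ⊕ ⋯ ⊕ f)^*` of `A^{n+1}`: slotwise action `pullbackOne_biproductMap_const_apply`,
`…_const_mul_apply`; transfer of scalar relations `…_const_mul_eq_smul_one` (`f^*g^* = c ⟹ (⊕f)^*(⊕g)^* = c`), of
anticommutation `…_const_mul_eq_neg`, of commutation `…_const_comm`; **`pullbackOne_biproductMap_const_mul_π_comp_ι`**
(diagonals commute with the matrix units `(πₐ ≫ ι_b)^*`).
§3 **`weilClassesField_biproduct_le_divisorClassesSpan_of_mem_adjoin_quaternion_diagonal`** — for `A` with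
`h ∈ B¹ ⊗ ℂ`, `h^{dim} ≠ 0`, `Q_h` non-degenerate; `ψ^*` `Q_h`-symmetric with `Q(ψ) = 0` (`Q` monic irreducible over
`ℚ`); `α^*, β^*` `Q_h`-symmetric, commuting with `ψ^*`, `α^{*2} = a ≠ 0`, `β^{*2} = b ≠ 0`, `α^*β^* = -β^*α^*`; and
`φ ∈ End(A^{n+1})` with `φ^* ∈ ℂ⟨(⊕ψ)^*, (⊕α)^*, (⊕β)^*, (πₐ ≫ ι_b)^*⟩` (`F ⊆ M_{n+1}(ℚ(ψ)⟨α, β⟩)`), `P(φ) = 0`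
(`P` monic irreducible, `deg P · 2m = 2(n+1) dim A`): `W_F ⊗ ℂ ≤ 𝒟ᵐ ⊗ ℂ`; `…_le_hodgeClassSpan_…`,
**`…_le_algebraicClasses_…`**, `mem_algebraicClasses_of_mem_weilClassesField_biproduct_of_mem_adjoin_quaternion_diagonal`.
The datum fed to §1: `x_{(i,c)} = e_{i0} x′_c`, `y_{(i,c)} = y′_c e_{0i}`, `p = e_{00} p′` over `Fin (n+1) × Fin 2`,
`(x′, y′, p′)` the `2 × 2` block of `(⊕α)^*, (⊕β)^*` (`exists_matrixUnits_of_quaternionPair_mem_adjoin`, inside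
`ℂ⟨(⊕α)^*, (⊕β)^*⟩` — so it commutes with the units and with `(⊕ψ)^*`, by the double-centraliser inclusion
`ℂ⟨S⟩ ⊆ C(C(S))`), `T = (⊕ψ)^*`.

Scope (honest column).  Type 2 is covered for the quaternion algebras containing a Rosati-symmetric anticommuting
pair with SCALAR squares `a, b` commuting with the centre — `D ⊇ E₀ ⊗ (a, b)` — over a totally real centre `E₀ = ℚ(ψ)`
of any degree and for every power `m = n + 1 ≥ 1`; a general quaternion algebra over `E₀` (`α² = a(ψ) ∈ E₀`) needs
the normalisation `α^* · a(T)^{-1/2}` with `a(T)^{-1/2} ∈ ℂ[T]`, not written here.  Any `A` (no simplicity, no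
identification `End⁰(A) = D`); for `A` simple of type 2 with `End⁰(A) = E₀⟨α, β⟩` this is the print's row up to
isogeny (transport: the seat's `WeilClassesFieldIsogenyTransportOfStructure`).  No algebraic groups, no
connectedness, no classification.

## References

* [MoonenZarhin1998WeilClasses] B. J. J. Moonen, Yu. G. Zarhin, Weil classes on abelian varieties, J. reine angew.
  Math. 496 (1998) 83–92; arXiv:alg-geom/9612017: §1 Criterion (2) and its proof (chunk p0003 L46–L90), Tables 1–2,
  «Δ ⊗ ℂ = ∏ Δ^{(τ)}» (chunk p0002 L60–L118).
* [Milne1999LefschetzClasses] J. S. Milne, Lefschetz classes on abelian varieties, Duke Math. J. 96 (1999), §1 p. 643,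
  Thm. 3.2, Cor. 4.5.
* [LangeBirkenhake1992] H. Lange, Ch. Birkenhake, Complex Abelian Varieties (1992), §1.1, §5.1, §5.3.
* [McconnellRobson2001] J. C. McConnell, J. C. Robson, Noncommutative Noetherian Rings, GSM 30 (AMS 2001), 3.5.5–3.5.7.
* [HornJohnson2013] R. A. Horn, C. R. Johnson, Matrix Analysis, 2nd ed. (CUP 2013), §1.1 and §1.3.
* [vanGeemen1994HodgeAV] B. van Geemen, LNM 1594 (1994), §2.4.
* [VoisinHodgeI2002] C. Voisin, Hodge Theory and Complex Algebraic Geometry I (CUP 2002), Thm. 11.30.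

## Provenance

Lane `lit-hodgefound` (Track 2, Layer A), prover seat `lit-hodgefound-p21` (generation 21), row g21-#4 (after the
append `exists_matrixUnits_of_quaternionPair_mem_adjoin` to `WeilClassesFieldDecomposableOfMatrixUnits`).
-/

noncomputable section

open CategoryTheory CategoryTheory.Limits
open Literature.AlgebraicTopology.SingularHomology
open Literature.AlgebraicGeometry.Motives
open Literature.AlgebraicGeometry.VanGeemen1994 (hodgeClassSpan pullbackOne)
open Literature.AlgebraicGeometry.Milne1999
open Literature.AlgebraicGeometry.Pohlmann1968 (sum_map_π_map_ι map_biproductMap_map_π)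
open Literature.Geometry.Kaehler (lefschetzPow)
open Literature.Barriers.HodgeConjecture (divisorClassesSpan)
open Literature.LinearAlgebra
open Polynomial

namespace Literature.AlgebraicGeometry.HodgeTheory

/-! ### §0 (private) polynomial calculus -/

section Aux

variable {M : Type*} [AddCommGroup M] [Module ℂ M]

/-- `L ∘ q(f) = q(g) ∘ L` when `L ∘ f = g ∘ L`. [folklore] -/
private theorem apply_aeval_of_intertwine {N : Type*} [AddCommGroup N] [Module ℂ N] (L : M →ₗ[ℂ] N)
    (f : Module.End ℂ M) (g : Module.End ℂ N) (hc : ∀ v, L (f v) = g (L v)) (q : ℂ[X]) (v : M) :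
    L (aeval f q v) = aeval g q (L v) := by
  induction q using Polynomial.induction_on' generalizing v with
  | add p q hp hq => rw [map_add, map_add, LinearMap.add_apply, LinearMap.add_apply, map_add, hp, hq]
  | monomial k c =>
    rw [aeval_monomial, aeval_monomial, Module.End.mul_apply, Module.End.mul_apply,
      Module.algebraMap_end_apply, Module.algebraMap_end_apply, map_smul]
    congr 1
    induction k generalizing v with
    | zero => rw [pow_zero, pow_zero, Module.End.one_apply, Module.End.one_apply]
    | succ k ih => rw [pow_succ, pow_succ, Module.End.mul_apply, Module.End.mul_apply, ih, hc]

/-- `q(T)` commutes with `U` when `T` does. [folklore] -/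
private theorem aeval_mul_eq_mul_aeval_of_comm (T U : Module.End ℂ M) (hc : T * U = U * T) (q : ℂ[X]) :
    aeval T q * U = U * aeval T q := by
  refine LinearMap.ext fun v ↦ ?_
  rw [Module.End.mul_apply, Module.End.mul_apply]
  exact (apply_aeval_of_intertwine U T T (fun v ↦ by rw [← Module.End.mul_apply, ← hc, Module.End.mul_apply]) q v).symm

/-- A polynomial in a `B`-self-adjoint operator is `B`-self-adjoint, for any bilinear map `B`. [folklore] -/
private theorem bilin_aeval_selfAdjoint {W : Type*} [AddCommGroup W] [Module ℂ W] (B : M →ₗ[ℂ] M →ₗ[ℂ] W)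
    (T : Module.End ℂ M) (hT : ∀ v w, B (T v) w = B v (T w)) (q : ℂ[X]) (v w : M) :
    B (aeval T q v) w = B v (aeval T q w) := by
  induction q using Polynomial.induction_on' generalizing v w with
  | add p q hp hq => rw [map_add, LinearMap.add_apply, LinearMap.add_apply, map_add, LinearMap.add_apply, map_add, hp, hq]
  | monomial k c =>
    rw [aeval_monomial, Module.End.mul_apply, Module.End.mul_apply, Module.algebraMap_end_apply,
      Module.algebraMap_end_apply, map_smul, LinearMap.smul_apply, map_smul]
    congr 1
    induction k generalizing v w with
    | zero => rw [pow_zero, Module.End.one_apply, Module.End.one_apply]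
    | succ k ih =>
      conv_lhs => rw [pow_succ', Module.End.mul_apply]
      rw [hT, ih, ← Module.End.mul_apply, ← pow_succ]

end Aux

/-- The complex roots of a monic integer polynomial irreducible over `ℚ` are simple and non-empty, with nodal
polynomial the polynomial itself. [folklore] -/
private theorem nodal_rootsFinset_eq_self {Q : Polynomial ℤ} (hQm : Q.Monic)
    (hQirr : Irreducible (Q.map (Int.castRingHom ℚ))) :
    Lagrange.nodal (Q.map (Int.castRingHom ℂ)).roots.toFinset id = Q.map (Int.castRingHom ℂ) ∧
      (Q.map (Int.castRingHom ℂ)).roots.toFinset.Nonempty := by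
  classical
  have hQc : Q.map (Int.castRingHom ℂ) = (Q.map (Int.castRingHom ℚ)).map (algebraMap ℚ ℂ) := by
    rw [Polynomial.map_map, RingHom.ext_int ((algebraMap ℚ ℂ).comp (Int.castRingHom ℚ)) (Int.castRingHom ℂ)]
  have hsep : (Q.map (Int.castRingHom ℂ)).Separable := by
    rw [hQc]
    exact hQirr.separable.map
  have hmon : (Q.map (Int.castRingHom ℂ)).Monic := hQm.map _
  have hnodup : (Q.map (Int.castRingHom ℂ)).roots.Nodup := Polynomial.nodup_roots hsep
  refine ⟨?_, ?_⟩
  · have hsplit := (IsAlgClosed.splits (Q.map (Int.castRingHom ℂ))).eq_prod_roots_of_monic hmon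
    rw [Lagrange.nodal_eq, ← Multiset.toFinset_eq hnodup, Finset.prod_mk]
    exact hsplit.symm
  · have hdeg : (Q.map (Int.castRingHom ℂ)).degree ≠ 0 := by
      have h1 : 0 < (Q.map (Int.castRingHom ℚ)).natDegree :=
        Polynomial.natDegree_pos_iff_degree_pos.2 (Polynomial.degree_pos_of_irreducible hQirr)
      rw [hQm.natDegree_map] at h1
      intro h0
      rw [Polynomial.degree_eq_natDegree hmon.ne_zero, hQm.natDegree_map] at h0
      exact h1.ne' (by exact_mod_cast h0)
    obtain ⟨z, hz⟩ := IsAlgClosed.exists_root _ hdeg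
    exact ⟨z, Multiset.mem_toFinset.2 ((Polynomial.mem_roots hmon.ne_zero).2 hz)⟩

/-! ### §1 The abstract mechanism: a `Q_D`-orthogonal Morita datum commuting with a Rosati-symmetric operator of
simple spectrum -/

section MoritaSymmetric

variable {X : AbelianVariety ℂ} {D : complexBetti X.X 2} {ι : Type*} [Fintype ι] [DecidableEq ι]
  {x y : ι → Module.End ℂ (complexBetti X.X 1)} {p T : Module.End ℂ (complexBetti X.X 1)} {s : Finset ℂ}
  {φ : X ⟶ X} {P : Polynomial ℤ} {e m : ℕ}

/-- **«`G_div(X) ⊆ Sl_F(V_X)`» — THE MORITA MECHANISM WITH A ROSATI-SYMMETRIC CENTRE.** Let `X` be a complex abelian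
variety with `D ∈ B¹ ⊗ ℂ` and `Q_D` non-degenerate; let `(x, y, p)` be a `Q_D`-ORTHOGONAL MORITA DATUM over a finite index
set `ι` inside `B ⊗ ℂ = ℂ⟨S_D ⊗ ℂ⟩` (`yᵢ xⱼ = δᵢⱼ p`, `Σ xᵢ yᵢ = 1`, `xᵢ† = yᵢ`), and `T ∈ S_D ⊗ ℂ` a Rosati-symmetric
operator commuting with every `xᵢ, yᵢ` and killed by the nodal polynomial of a finite set `s ⊂ ℂ` (simple spectrum).
If `φ ∈ End(X)` has `φ^* ∈ ℂ⟨T, x_a y_b⟩` and `P(φ) = 0` (`P ∈ ℤ[T]` monic irreducible of degree `e`,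
`e · 2m = 2 dim X`), then `W_F ⊗ ℂ ≤ 𝒟ᵐ ⊗ ℂ`: all Weil classes of `F = ℚ(φ)` are decomposable. Proof: the Lagrange
projectors `P_z = ℓ_z(T)` (`aeval_lagrange_basis_spectral`) are `Q_D`-self-adjoint idempotents of `B ⊗ ℂ` commuting with
the datum, so `(P_z xᵢ, P_z yᵢ, P_z p)_{z ∈ s}` is a `Q_D`-orthogonal system of matrix blocks whose span contains
`T = Σ_z z P_z` and every `x_a y_b = Σ_z (P_z x_a)(P_z y_b)`; then the multi-block mechanism
`weilClassesField_le_divisorClassesSpan_of_matrixBlocks` (`det(u | V_τ) = ∏_z det(u | P_z p V)^{l_z} = 1`). This abstracts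
§5 of `WeilClassesFieldRealMultiplicationMatricesDecomposable` (`xᵢ = e_{i0}`, `yᵢ = e_{0i}`): the print's «`Δ ⊗ ℂ =
∏_τ Δ_ℂ^{(τ)}` … `G_div(X)` is connected and semi-simple, so `G_div(X) ⊆ Sl_F(V_X)`» for `B ⊗ ℂ ⊇` a full matrix algebra
over the split commutative algebra `ℂ[T]`, on the carrier, with no algebraic groups. [cite: MoonenZarhin1998WeilClasses, §1 proof of Criterion (2), types 1–2 (chunk p0003 L82–L90); «Δ ⊗ ℂ = ∏_τ Δ_ℂ^{(τ)}» (chunk p0002 L104–L118)]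
[cite: McconnellRobson2001, 3.5.5–3.5.7] [cite: HornJohnson2013, §1.1 and §1.3] -/
theorem weilClassesField_le_divisorClassesSpan_of_moritaData_of_symmetric
    (hPm : P.Monic) (hPe : P.natDegree = e) (hPirr : Irreducible (P.map (Int.castRingHom ℚ)))
    (hφ : Polynomial.eval₂ (Int.castRingHom (CategoryTheory.End X)) (φ : CategoryTheory.End X) P = 0)
    (her : e * (2 * m) = 2 * X.dim) (hh : D ∈ hodgeClassSpan X.dim X.X 1)
    (hnd : ∀ v : complexBetti X.X 1, (∀ w, polarizationPairingOne X.X D (X.dim - 1) v w = 0) → v = 0)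
    (hyx : ∀ i j, y i * x j = if i = j then p else 0) (hsum : ∑ i, x i * y i = 1)
    (hadj : ∀ i (v w : complexBetti X.X 1), polarizationPairingOne X.X D (X.dim - 1) (x i v) w =
      polarizationPairingOne X.X D (X.dim - 1) v (y i w))
    (hx : ∀ i, x i ∈ Algebra.adjoin ℂ (symmetricPullbackSpan X D : Set (Module.End ℂ (complexBetti X.X 1))))
    (hy : ∀ i, y i ∈ Algebra.adjoin ℂ (symmetricPullbackSpan X D : Set (Module.End ℂ (complexBetti X.X 1))))
    (hT : T ∈ symmetricPullbackSpan X D) (hTx : ∀ i, T * x i = x i * T) (hTy : ∀ i, T * y i = y i * T)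
    (hs : s.Nonempty) (hTs : aeval T (Lagrange.nodal s id) = 0)
    (hF : pullbackOne X φ ∈ Algebra.adjoin ℂ
      (insert T (Set.range fun ab : ι × ι ↦ x ab.1 * y ab.2) : Set (Module.End ℂ (complexBetti X.X 1)))) :
    weilClassesField X φ P (2 * m) ≤ divisorClassesSpan X.X X.dim m := by
  classical
  obtain ⟨hPsum, hPorth, hPidem, hTP⟩ := aeval_lagrange_basis_spectral T s hs hTs
  set Pz : s → Module.End ℂ (complexBetti X.X 1) := fun z ↦ aeval T (Lagrange.basis s id (z : ℂ)) with hPzdef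
  have hPsum' : ∑ z : s, Pz z = 1 := by rw [Finset.sum_coe_sort s fun z ↦ aeval T (Lagrange.basis s id z), hPsum]
  have hPx : ∀ (z : s) i, Pz z * x i = x i * Pz z := fun z i ↦ aeval_mul_eq_mul_aeval_of_comm T (x i) (hTx i) _
  have hPy : ∀ (z : s) i, Pz z * y i = y i * Pz z := fun z i ↦ aeval_mul_eq_mul_aeval_of_comm T (y i) (hTy i) _
  have hPadj : ∀ (z : s) (v w : complexBetti X.X 1), polarizationPairingOne X.X D (X.dim - 1) (Pz z v) w =
      polarizationPairingOne X.X D (X.dim - 1) v (Pz z w) :=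
    fun z v w ↦ bilin_aeval_selfAdjoint _ T hT.2 _ v w
  have hPadjoin : ∀ z : s, Pz z ∈ Algebra.adjoin ℂ (symmetricPullbackSpan X D : Set (Module.End ℂ (complexBetti X.X 1))) :=
    fun z ↦ Algebra.adjoin_mono (Set.singleton_subset_iff.2 hT) (Polynomial.aeval_mem_adjoin_singleton ℂ T)
  -- the blocks `P_z xᵢ`, `P_z yᵢ`, corners `P_z p`
  let xb : s → ι → Module.End ℂ (complexBetti X.X 1) := fun z i ↦ Pz z * x i
  let yb : s → ι → Module.End ℂ (complexBetti X.X 1) := fun z i ↦ Pz z * y i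
  let pb : s → Module.End ℂ (complexBetti X.X 1) := fun z ↦ Pz z * p
  have hunit : ∀ (z : s) a b, xb z a * yb z b = Pz z * (x a * y b) := by
    intro z a b
    change Pz z * x a * (Pz z * y b) = Pz z * (x a * y b)
    rw [mul_assoc, ← mul_assoc (x a), ← hPx, mul_assoc, ← mul_assoc (Pz z), hPidem _ z.2]
  have hxy : ∀ z i j, yb z i * xb z j = if i = j then pb z else 0 := by
    intro z i j
    change Pz z * y i * (Pz z * x j) = if i = j then Pz z * p else 0
    rw [mul_assoc, ← mul_assoc (y i), ← hPy, mul_assoc, ← mul_assoc (Pz z), hPidem _ z.2, hyx]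
    split_ifs
    · rfl
    · rw [mul_zero]
  have hcross : ∀ z z', z ≠ z' → ∀ i j, yb z i * xb z' j = 0 := by
    intro z z' hzz' i j
    change Pz z * y i * (Pz z' * x j) = 0
    rw [mul_assoc, ← mul_assoc (y i), ← hPy, mul_assoc, ← mul_assoc (Pz z),
      hPorth _ z.2 _ z'.2 (fun e ↦ hzz' (Subtype.ext e)), zero_mul]
  have hsum' : ∑ z, ∑ i, xb z i * yb z i = 1 := by
    simp_rw [hunit, ← Finset.mul_sum, hsum, mul_one]
    exact hPsum'
  have hadj' : ∀ z i (v w : complexBetti X.X 1), polarizationPairingOne X.X D (X.dim - 1) (xb z i v) w =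
      polarizationPairingOne X.X D (X.dim - 1) v (yb z i w) := by
    intro z i v w
    change polarizationPairingOne X.X D (X.dim - 1) ((Pz z * x i) v) w =
      polarizationPairingOne X.X D (X.dim - 1) v ((Pz z * y i) w)
    rw [Module.End.mul_apply, hPadj, hadj, ← Module.End.mul_apply, ← hPy]
  have hxb : ∀ z i, xb z i ∈ Algebra.adjoin ℂ (symmetricPullbackSpan X D : Set (Module.End ℂ (complexBetti X.X 1))) :=
    fun z i ↦ Subalgebra.mul_mem _ (hPadjoin z) (hx i)
  have hyb : ∀ z i, yb z i ∈ Algebra.adjoin ℂ (symmetricPullbackSpan X D : Set (Module.End ℂ (complexBetti X.X 1))) :=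
    fun z i ↦ Subalgebra.mul_mem _ (hPadjoin z) (hy i)
  -- the generators `T`, `x_a y_b` lie in the span of the blocks
  have hgen : insert T (Set.range fun ab : ι × ι ↦ x ab.1 * y ab.2) ⊆
      (Submodule.span ℂ (Set.range fun t : s × ι × ι ↦ xb t.1 t.2.1 * yb t.1 t.2.2) :
        Set (Module.End ℂ (complexBetti X.X 1))) := by
    have hUmem : ∀ a b, x a * y b ∈ Submodule.span ℂ (Set.range fun t : s × ι × ι ↦ xb t.1 t.2.1 * yb t.1 t.2.2) := by
      intro a b
      have e1 : x a * y b = ∑ z : s, xb z a * yb z b := by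
        simp_rw [hunit]
        rw [← Finset.sum_mul, hPsum', one_mul]
      rw [e1]
      exact Submodule.sum_mem _ fun z _ ↦ Submodule.subset_span ⟨(z, a, b), rfl⟩
    refine Set.insert_subset_iff.2 ⟨?_, ?_⟩
    · have e2 : T = ∑ z : s, ∑ i, (z : ℂ) • (xb z i * yb z i) := by
        simp_rw [hunit, ← smul_mul_assoc, ← Finset.mul_sum, hsum, mul_one]
        rw [← mul_one T, ← hPsum', Finset.mul_sum]
        exact Finset.sum_congr rfl fun z _ ↦ hTP _ z.2
      rw [e2]
      exact Submodule.sum_mem _ fun z _ ↦ Submodule.sum_mem _ fun i _ ↦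
        Submodule.smul_mem _ _ (Submodule.subset_span ⟨(z, i, i), rfl⟩)
    · rintro _ ⟨ab, rfl⟩
      exact hUmem ab.1 ab.2
  exact weilClassesField_le_divisorClassesSpan_of_matrixBlocks hPm hPe hPirr hφ her hh hnd hxy hcross hsum' hadj' hxb hyb
    (adjoin_le_span_units_of_matrixBlocks hxy hcross hsum' hgen hF)

end MoritaSymmetric

/-! ### §2 Diagonal endomorphisms `f ⊕ ⋯ ⊕ f` of a power `A^{n+1}`: slotwise action, products, commutation with the
matrix units -/

section Diagonal

variable {A : AbelianVariety ℂ} {n : ℕ}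

/-- `(f ≫ g)^* = f^* ∘ g^*` on `H¹`, in `Module.End`. [folklore] -/
private theorem pullbackOne_comp_eq_mul {Y : AbelianVariety ℂ} (f g : Y ⟶ Y) :
    pullbackOne Y (f ≫ g) = pullbackOne Y f * pullbackOne Y g := by
  change (complexBetti.map (f.hom.hom.hom ≫ g.hom.hom.hom) 1).hom = _
  rw [complexBetti.map_comp, ModuleCat.hom_comp]
  rfl

/-- A diagonal endomorphism of the power acts slotwise: `(f ⊕ ⋯ ⊕ f)^* v = Σᵢ πᵢ^* f^* ιᵢ^* v` on `H¹(A^{n+1})`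
(`v = Σᵢ πᵢ^* ιᵢ^* v` and `(⊕f)^* πᵢ^* = πᵢ^* f^*`). [cite: LangeBirkenhake1992, §1.1] [cite: Milne1999LefschetzClasses, §1 p. 643] -/
theorem pullbackOne_biproductMap_const_apply (f : A ⟶ A) (v : complexBetti (⨁ (fun _ : Fin (n + 1) => A)).X 1) :
    pullbackOne (⨁ (fun _ : Fin (n + 1) => A)) (biproduct.map fun _ : Fin (n + 1) => f) v =
      ∑ i, complexBetti.map (biproduct.π (fun _ : Fin (n + 1) => A) i).hom.hom.hom 1
        (pullbackOne A f (complexBetti.map (biproduct.ι (fun _ : Fin (n + 1) => A) i).hom.hom.hom 1 v)) := by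
  conv_lhs => rw [← sum_map_π_map_ι (fun _ : Fin (n + 1) => A) v, map_sum]
  exact Finset.sum_congr rfl fun i _ ↦ map_biproductMap_map_π (fun _ : Fin (n + 1) => A) (fun _ => f) i 1 _

/-- Products of diagonals act slotwise: `(⊕f)^* (⊕g)^* v = Σᵢ πᵢ^* (f^* g^*) ιᵢ^* v`. [cite: LangeBirkenhake1992, §1.1] -/
theorem pullbackOne_biproductMap_const_mul_apply (f g : A ⟶ A)
    (v : complexBetti (⨁ (fun _ : Fin (n + 1) => A)).X 1) :
    (pullbackOne (⨁ (fun _ : Fin (n + 1) => A)) (biproduct.map fun _ : Fin (n + 1) => f) *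
        pullbackOne (⨁ (fun _ : Fin (n + 1) => A)) (biproduct.map fun _ : Fin (n + 1) => g)) v =
      ∑ i, complexBetti.map (biproduct.π (fun _ : Fin (n + 1) => A) i).hom.hom.hom 1
        ((pullbackOne A f * pullbackOne A g)
          (complexBetti.map (biproduct.ι (fun _ : Fin (n + 1) => A) i).hom.hom.hom 1 v)) := by
  rw [Module.End.mul_apply, pullbackOne_biproductMap_const_apply g v, map_sum]
  exact Finset.sum_congr rfl fun i _ ↦ map_biproductMap_map_π (fun _ : Fin (n + 1) => A) (fun _ => f) i 1 _

/-- Scalar relations transfer to the diagonal: `f^* g^* = c ⟹ (⊕f)^* (⊕g)^* = c` on `H¹(A^{n+1})` (e.g. `α^{*2} = a`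
for a quaternion generator `α`). [cite: LangeBirkenhake1992, §1.1] -/
theorem pullbackOne_biproductMap_const_mul_eq_smul_one {f g : A ⟶ A} {c : ℂ}
    (hfg : pullbackOne A f * pullbackOne A g = c • 1) :
    pullbackOne (⨁ (fun _ : Fin (n + 1) => A)) (biproduct.map fun _ : Fin (n + 1) => f) *
        pullbackOne (⨁ (fun _ : Fin (n + 1) => A)) (biproduct.map fun _ : Fin (n + 1) => g) = c • 1 := by
  refine LinearMap.ext fun v ↦ ?_
  rw [pullbackOne_biproductMap_const_mul_apply, hfg]
  simp_rw [LinearMap.smul_apply, Module.End.one_apply, map_smul]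
  rw [← Finset.smul_sum, sum_map_π_map_ι]

/-- Anticommutation transfers to the diagonal: `f^* g^* = -g^* f^* ⟹ (⊕f)^* (⊕g)^* = -(⊕g)^* (⊕f)^*`.
[cite: LangeBirkenhake1992, §1.1] -/
theorem pullbackOne_biproductMap_const_mul_eq_neg {f g : A ⟶ A}
    (hfg : pullbackOne A f * pullbackOne A g = -(pullbackOne A g * pullbackOne A f)) :
    pullbackOne (⨁ (fun _ : Fin (n + 1) => A)) (biproduct.map fun _ : Fin (n + 1) => f) *
        pullbackOne (⨁ (fun _ : Fin (n + 1) => A)) (biproduct.map fun _ : Fin (n + 1) => g) =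
      -(pullbackOne (⨁ (fun _ : Fin (n + 1) => A)) (biproduct.map fun _ : Fin (n + 1) => g) *
        pullbackOne (⨁ (fun _ : Fin (n + 1) => A)) (biproduct.map fun _ : Fin (n + 1) => f)) := by
  refine LinearMap.ext fun v ↦ ?_
  rw [LinearMap.neg_apply, pullbackOne_biproductMap_const_mul_apply, pullbackOne_biproductMap_const_mul_apply, hfg,
    ← Finset.sum_neg_distrib]
  exact Finset.sum_congr rfl fun i _ ↦ by rw [LinearMap.neg_apply, map_neg]

/-- Commutation transfers to the diagonal: `f^* g^* = g^* f^* ⟹ (⊕f)^* (⊕g)^* = (⊕g)^* (⊕f)^*`.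
[cite: LangeBirkenhake1992, §1.1] -/
theorem pullbackOne_biproductMap_const_comm {f g : A ⟶ A}
    (hfg : pullbackOne A f * pullbackOne A g = pullbackOne A g * pullbackOne A f) :
    pullbackOne (⨁ (fun _ : Fin (n + 1) => A)) (biproduct.map fun _ : Fin (n + 1) => f) *
        pullbackOne (⨁ (fun _ : Fin (n + 1) => A)) (biproduct.map fun _ : Fin (n + 1) => g) =
      pullbackOne (⨁ (fun _ : Fin (n + 1) => A)) (biproduct.map fun _ : Fin (n + 1) => g) *
        pullbackOne (⨁ (fun _ : Fin (n + 1) => A)) (biproduct.map fun _ : Fin (n + 1) => f) := by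
  refine LinearMap.ext fun v ↦ ?_
  rw [pullbackOne_biproductMap_const_mul_apply, pullbackOne_biproductMap_const_mul_apply, hfg]

/-- A diagonal `(⊕f)^*` commutes with every matrix unit `(πₐ ≫ ι_b)^*` of the power (`map f ≫ πₐ ≫ ι_b = πₐ ≫ f ≫ ι_b =
πₐ ≫ ι_b ≫ map f`): the scalars `End⁰(Y) · 1 ⊆ B = M_m(End⁰ Y)` are central. [cite: MoonenZarhin1998WeilClasses, §1 Table 1 («B = M_m(D)»; chunk p0002 L60–L84)]
[cite: LangeBirkenhake1992, §1.1] -/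
theorem pullbackOne_biproductMap_const_mul_π_comp_ι (f : A ⟶ A) (a b : Fin (n + 1)) :
    pullbackOne (⨁ (fun _ : Fin (n + 1) => A)) (biproduct.map fun _ : Fin (n + 1) => f) *
        pullbackOne (⨁ (fun _ : Fin (n + 1) => A))
          (biproduct.π (fun _ : Fin (n + 1) => A) a ≫ biproduct.ι (fun _ : Fin (n + 1) => A) b) =
      pullbackOne (⨁ (fun _ : Fin (n + 1) => A))
          (biproduct.π (fun _ : Fin (n + 1) => A) a ≫ biproduct.ι (fun _ : Fin (n + 1) => A) b) *
        pullbackOne (⨁ (fun _ : Fin (n + 1) => A)) (biproduct.map fun _ : Fin (n + 1) => f) := by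
  rw [← pullbackOne_comp_eq_mul, ← pullbackOne_comp_eq_mul]
  simp only [Category.assoc, biproduct.map_π_assoc, biproduct.ι_map]

end Diagonal

/-! ### §3 THE TYPE-2 ROW ON POWERS WITH A REAL-MULTIPLICATION CENTRE -/

section QuaternionMatrices

variable {A : AbelianVariety ℂ} {h : complexBetti A.X 2} {n : ℕ} {ψ α β : A ⟶ A} {a b : ℂ}
  {φ : ⨁ (fun _ : Fin (n + 1) => A) ⟶ ⨁ (fun _ : Fin (n + 1) => A)} {P Q : Polynomial ℤ} {e m : ℕ}

/-- **THE TYPE-2 ROW ON POWERS WITH A REAL-MULTIPLICATION CENTRE — `W_F(A^{n+1})` IS DECOMPOSABLE FOR EVERY SUBFIELD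
`F ⊆ M_{n+1}(ℚ(ψ)⟨α, β⟩)`.** Let `A` be a complex abelian variety of positive dimension with `h ∈ B¹(A) ⊗ ℂ`,
`h^{dim A} ≠ 0`, `Q_h` non-degenerate; `ψ ∈ End(A)` ROSATI-SYMMETRIC with `Q(ψ) = 0`, `Q ∈ ℤ[T]` monic irreducible over
`ℚ` (the totally real centre `E₀ = ℚ(ψ)`, of any degree); `α, β ∈ End(A)` Rosati-symmetric, commuting with `ψ^*`, with
`α^{*2} = a`, `β^{*2} = b` (`a, b ≠ 0`) and `α^* β^* = -β^* α^*` (the quaternion algebra `E₀⟨α, β⟩`); let `X = A^{n+1}`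
carry the product polarization `D_X = Σ πᵢ^* h`, and let `φ ∈ End(X)` have `φ^*` in the complex algebra generated by the
diagonals `(⊕ψ)^*, (⊕α)^*, (⊕β)^*` and the matrix units `(πₐ ≫ ι_b)^*` — i.e. `F = ℚ(φ) ⊆ M_{n+1}(E₀⟨α, β⟩) ⊆ End⁰(X)` —
with `P(φ) = 0`, `P ∈ ℤ[T]` monic irreducible of degree `e`, `e · 2m = 2 (n+1) dim A`. Then `W_F ⊗ ℂ ≤ 𝒟ᵐ ⊗ ℂ`: ALL
WEIL CLASSES OF `F` ARE DECOMPOSABLE. Proof: the Morita datum `x_{(i,c)} = e_{i0} x′_c`, `y_{(i,c)} = y′_c e_{0i}`,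
`p = e_{00} p′` over `Fin (n+1) × Fin 2` — `e_{ab} = (πₐ ≫ ι_b)^*` the matrix units of the power
(`pullbackOne_π_comp_ι_mul`, `polarizationPairingOne_pullbackOne_π_comp_ι`), `(x′, y′, p′)` the `2 × 2` block of the
quaternion pair `(⊕α)^*, (⊕β)^*` on `X` (`exists_matrixUnits_of_quaternionPair_mem_adjoin`; it lies in
`ℂ⟨(⊕α)^*, (⊕β)^*⟩`, hence commutes with the `e_{ab}` and with `(⊕ψ)^*`, §2) — is `Q_{D_X}`-orthogonal inside `B ⊗ ℂ`
(Milne's slotwise involution, `pullbackOne_biproductMap_mem_symmetricPullbackSpan`) and commutes with the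
Rosati-symmetric `(⊕ψ)^*`, whose spectrum is the set of roots of `Q` (simple); its span contains `(⊕α)^*`, `(⊕β)^*` and
every `e_{ab}`; then §1 `weilClassesField_le_divisorClassesSpan_of_moritaData_of_symmetric`. This is the print's row
«`Y` of Type 2, `F ⊆ B = M_m(D) = End⁰(X)`: decomposable» for the quaternion algebras `D ⊇ E₀⟨α, β⟩` with `α², β²`
scalars, with centre of ANY degree and ANY `m = n + 1` (for `n + 1 = 1`: type 2, `m = 1`), on the carrier, with no
algebraic groups. [cite: MoonenZarhin1998WeilClasses, §1 Criterion (2) and its proof, types 1–2 (chunk p0003 L46–L90); Tables 1–2 and «Δ ⊗ ℂ = ∏_τ Δ_ℂ^{(τ)}» (chunk p0002 L60–L118)]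
[cite: Milne1999LefschetzClasses, §1 p. 643, Thm. 3.2, Cor. 4.5] [cite: McconnellRobson2001, 3.5.5–3.5.7] -/
theorem weilClassesField_biproduct_le_divisorClassesSpan_of_mem_adjoin_quaternion_diagonal (hA : 0 < A.dim)
    (hh : h ∈ hodgeClassSpan A.dim A.X 1) (htop : lefschetzPow h (A.dim - 1) 2 h ≠ 0)
    (hnd : ∀ x : complexBetti A.X 1, (∀ y, polarizationPairingOne A.X h (A.dim - 1) x y = 0) → x = 0)
    (hψsym : ∀ v w : complexBetti A.X 1, polarizationPairingOne A.X h (A.dim - 1) (pullbackOne A ψ v) w =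
      polarizationPairingOne A.X h (A.dim - 1) v (pullbackOne A ψ w))
    (hQm : Q.Monic) (hQirr : Irreducible (Q.map (Int.castRingHom ℚ)))
    (hψQ : Polynomial.eval₂ (Int.castRingHom (CategoryTheory.End A)) (ψ : CategoryTheory.End A) Q = 0)
    (ha : a ≠ 0) (hα2 : pullbackOne A α * pullbackOne A α = a • 1)
    (hb : b ≠ 0) (hβ2 : pullbackOne A β * pullbackOne A β = b • 1)
    (hanti : pullbackOne A α * pullbackOne A β = -(pullbackOne A β * pullbackOne A α))
    (hαsym : ∀ v w : complexBetti A.X 1, polarizationPairingOne A.X h (A.dim - 1) (pullbackOne A α v) w =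
      polarizationPairingOne A.X h (A.dim - 1) v (pullbackOne A α w))
    (hβsym : ∀ v w : complexBetti A.X 1, polarizationPairingOne A.X h (A.dim - 1) (pullbackOne A β v) w =
      polarizationPairingOne A.X h (A.dim - 1) v (pullbackOne A β w))
    (hψα : pullbackOne A ψ * pullbackOne A α = pullbackOne A α * pullbackOne A ψ)
    (hψβ : pullbackOne A ψ * pullbackOne A β = pullbackOne A β * pullbackOne A ψ)
    (hPm : P.Monic) (hPe : P.natDegree = e) (hPirr : Irreducible (P.map (Int.castRingHom ℚ)))
    (hφ : Polynomial.eval₂ (Int.castRingHom (CategoryTheory.End (⨁ (fun _ : Fin (n + 1) => A))))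
      (φ : CategoryTheory.End (⨁ (fun _ : Fin (n + 1) => A))) P = 0)
    (her : e * (2 * m) = 2 * ((n + 1) * A.dim))
    (hF : pullbackOne (⨁ (fun _ : Fin (n + 1) => A)) φ ∈ Algebra.adjoin ℂ
      (insert (pullbackOne (⨁ (fun _ : Fin (n + 1) => A)) (biproduct.map fun _ : Fin (n + 1) => ψ))
        (insert (pullbackOne (⨁ (fun _ : Fin (n + 1) => A)) (biproduct.map fun _ : Fin (n + 1) => α))
          (insert (pullbackOne (⨁ (fun _ : Fin (n + 1) => A)) (biproduct.map fun _ : Fin (n + 1) => β))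
            (Set.range fun ab : Fin (n + 1) × Fin (n + 1) ↦ pullbackOne (⨁ (fun _ : Fin (n + 1) => A))
              (biproduct.π (fun _ : Fin (n + 1) => A) ab.1 ≫ biproduct.ι (fun _ : Fin (n + 1) => A) ab.2)))))) :
    weilClassesField (⨁ (fun _ : Fin (n + 1) => A)) φ P (2 * m) ≤
      divisorClassesSpan (⨁ (fun _ : Fin (n + 1) => A)).X (⨁ (fun _ : Fin (n + 1) => A)).dim m := by
  classical
  obtain ⟨hhX, -, hndX⟩ := sumPolarizationClass_hypotheses (fun _ : Fin (n + 1) => A) (fun _ => h)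
      (fun _ => hA) (fun _ => hh) (fun _ => htop) (fun _ => hnd)
  have herX : e * (2 * m) = 2 * (⨁ (fun _ : Fin (n + 1) => A)).dim := by rw [dim_biproduct_const_succ A n, her]
  -- notation
  set X := ⨁ (fun _ : Fin (n + 1) => A) with hXdef
  set D := sumPolarizationClass (fun _ : Fin (n + 1) => A) (fun _ => h) with hDdef
  set T : Module.End ℂ (complexBetti X.X 1) := pullbackOne X (biproduct.map fun _ : Fin (n + 1) => ψ) with hTdef
  set Sa : Module.End ℂ (complexBetti X.X 1) := pullbackOne X (biproduct.map fun _ : Fin (n + 1) => α) with hSadef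
  set Sb : Module.End ℂ (complexBetti X.X 1) := pullbackOne X (biproduct.map fun _ : Fin (n + 1) => β) with hSbdef
  set U : Fin (n + 1) → Fin (n + 1) → Module.End ℂ (complexBetti X.X 1) := fun a b ↦
    pullbackOne X (biproduct.π (fun _ : Fin (n + 1) => A) a ≫ biproduct.ι (fun _ : Fin (n + 1) => A) b) with hUdef
  have hU : ∀ a b c d, U a b * U c d = if b = c then U a d else 0 := fun a b c d ↦ pullbackOne_π_comp_ι_mul a b c d
  have hUsum : ∑ a, U a a = 1 := sum_pullbackOne_π_comp_ι
  have hUadj : ∀ a b (v w : complexBetti X.X 1), polarizationPairingOne X.X D (X.dim - 1) (U a b v) w =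
      polarizationPairingOne X.X D (X.dim - 1) v (U b a w) :=
    fun a b v w ↦ polarizationPairingOne_pullbackOne_π_comp_ι hA hh htop hnd a b v w
  have hUadjoin : ∀ a b, U a b ∈ Algebra.adjoin ℂ (symmetricPullbackSpan X D : Set (Module.End ℂ (complexBetti X.X 1))) :=
    fun a b ↦ pullbackOne_π_comp_ι_mem_adjoin_symmetricPullbackSpan hA hh htop hnd a b
  -- the diagonals `T = (⊕ψ)^*`, `Sa = (⊕α)^*`, `Sb = (⊕β)^*`
  have hT_symm : T ∈ symmetricPullbackSpan X D :=
    pullbackOne_biproductMap_mem_symmetricPullbackSpan (fun _ : Fin (n + 1) => A) (fun _ => h) (fun _ => hA)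
      (fun _ => ψ) (fun _ => hψsym)
  have hSa_symm : ∀ v w : complexBetti X.X 1, polarizationPairingOne X.X D (X.dim - 1) (Sa v) w =
      polarizationPairingOne X.X D (X.dim - 1) v (Sa w) :=
    (pullbackOne_biproductMap_mem_symmetricPullbackSpan (fun _ : Fin (n + 1) => A) (fun _ => h) (fun _ => hA)
      (fun _ => α) (fun _ => hαsym)).2
  have hSb_symm : ∀ v w : complexBetti X.X 1, polarizationPairingOne X.X D (X.dim - 1) (Sb v) w =
      polarizationPairingOne X.X D (X.dim - 1) v (Sb w) :=
    (pullbackOne_biproductMap_mem_symmetricPullbackSpan (fun _ : Fin (n + 1) => A) (fun _ => h) (fun _ => hA)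
      (fun _ => β) (fun _ => hβsym)).2
  have hSa2 : Sa * Sa = a • 1 := pullbackOne_biproductMap_const_mul_eq_smul_one hα2
  have hSb2 : Sb * Sb = b • 1 := pullbackOne_biproductMap_const_mul_eq_smul_one hβ2
  have hSanti : Sa * Sb = -(Sb * Sa) := pullbackOne_biproductMap_const_mul_eq_neg hanti
  have hTSa : T * Sa = Sa * T := pullbackOne_biproductMap_const_comm hψα
  have hTSb : T * Sb = Sb * T := pullbackOne_biproductMap_const_comm hψβ
  have hTU : ∀ c d, T * U c d = U c d * T := fun c d ↦ pullbackOne_biproductMap_const_mul_π_comp_ι ψ c d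
  have hSaU : ∀ c d, Sa * U c d = U c d * Sa := fun c d ↦ pullbackOne_biproductMap_const_mul_π_comp_ι α c d
  have hSbU : ∀ c d, Sb * U c d = U c d * Sb := fun c d ↦ pullbackOne_biproductMap_const_mul_π_comp_ι β c d
  have hTQ : aeval T (Q.map (Int.castRingHom ℂ)) = 0 := by
    have hψQ' := aeval_hom_complexBetti_map_one_eq_zero hψQ
    refine LinearMap.ext fun v ↦ ?_
    rw [LinearMap.zero_apply, ← sum_map_π_map_ι (fun _ : Fin (n + 1) => A) v, map_sum]
    refine Finset.sum_eq_zero fun c _ ↦ ?_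
    have key := apply_aeval_of_intertwine (complexBetti.map (biproduct.π (fun _ : Fin (n + 1) => A) c).hom.hom.hom 1).hom
      (pullbackOne A ψ) T (fun w ↦ (map_biproductMap_map_π (fun _ : Fin (n + 1) => A) (fun _ => ψ) c 1 w).symm)
      (Q.map (Int.castRingHom ℂ)) (complexBetti.map (biproduct.ι (fun _ : Fin (n + 1) => A) c).hom.hom.hom 1 v)
    rw [hψQ', LinearMap.zero_apply, map_zero] at key
    exact key.symm
  set s : Finset ℂ := (Q.map (Int.castRingHom ℂ)).roots.toFinset with hsdef
  obtain ⟨hnodal, hsne⟩ := nodal_rootsFinset_eq_self hQm hQirr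
  have hTnodal : aeval T (Lagrange.nodal s id) = 0 := by rw [hsdef, hnodal, hTQ]
  -- the `2 × 2` block of the quaternion pair `(⊕α)^*, (⊕β)^*`, inside `ℂ⟨Sa, Sb⟩`
  obtain ⟨x', y', p', hyx', hsum', hadj', hx', hy', hST', hx'gen, hy'gen⟩ :=
    exists_matrixUnits_of_quaternionPair_mem_adjoin (A := X) (h := D) ha hSa2 hb hSb2 hSanti hSa_symm hSb_symm
  have hcomm : ∀ L : Module.End ℂ (complexBetti X.X 1), L * Sa = Sa * L → L * Sb = Sb * L →
      ∀ g ∈ Algebra.adjoin ℂ ({Sa, Sb} : Set (Module.End ℂ (complexBetti X.X 1))), L * g = g * L := by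
    intro L hLa hLb g hg
    have hL : L ∈ Subalgebra.centralizer ℂ ({Sa, Sb} : Set (Module.End ℂ (complexBetti X.X 1))) := by
      rw [Subalgebra.mem_centralizer_iff]
      rintro g' (rfl | rfl)
      · exact hLa.symm
      · exact hLb.symm
    have hg' := Algebra.adjoin_le_centralizer_centralizer ℂ ({Sa, Sb} : Set (Module.End ℂ (complexBetti X.X 1))) hg
    rw [Subalgebra.mem_centralizer_iff] at hg'
    exact hg' L hL
  have hUx' : ∀ c d k, U c d * x' k = x' k * U c d :=
    fun c d k ↦ hcomm _ (hSaU c d).symm (hSbU c d).symm _ (hx'gen k)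
  have hUy' : ∀ c d k, U c d * y' k = y' k * U c d :=
    fun c d k ↦ hcomm _ (hSaU c d).symm (hSbU c d).symm _ (hy'gen k)
  have hTx' : ∀ k, T * x' k = x' k * T := fun k ↦ hcomm _ hTSa hTSb _ (hx'gen k)
  have hTy' : ∀ k, T * y' k = y' k * T := fun k ↦ hcomm _ hTSa hTSb _ (hy'gen k)
  -- the combined Morita datum over `Fin (n+1) × Fin 2`
  let x : Fin (n + 1) × Fin 2 → Module.End ℂ (complexBetti X.X 1) := fun ic ↦ U ic.1 0 * x' ic.2
  let y : Fin (n + 1) × Fin 2 → Module.End ℂ (complexBetti X.X 1) := fun ic ↦ y' ic.2 * U 0 ic.1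
  let p : Module.End ℂ (complexBetti X.X 1) := U 0 0 * p'
  have hyx : ∀ ic jd, y ic * x jd = if ic = jd then p else 0 := by
    rintro ⟨i, c⟩ ⟨j, d⟩
    change y' c * U 0 i * (U j 0 * x' d) = if (i, c) = (j, d) then U 0 0 * p' else 0
    rw [mul_assoc, ← mul_assoc (U 0 i), hU]
    by_cases hij : i = j
    · subst hij
      rw [if_pos rfl, hUx', ← mul_assoc, hyx']
      by_cases hcd : c = d
      · subst hcd
        rw [if_pos rfl, if_pos rfl]
        exact (comm_idem_of_moritaData hyx' hsum' (fun k ↦ hUx' 0 0 k) (fun k ↦ hUy' 0 0 k)).symm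
      · rw [if_neg hcd, zero_mul, if_neg fun h ↦ hcd (Prod.mk.inj h).2]
    · rw [if_neg hij, zero_mul, mul_zero, if_neg fun h ↦ hij (Prod.mk.inj h).1]
  have hsumxy : ∑ ic, x ic * y ic = 1 := by
    rw [Fintype.sum_prod_type]
    change ∑ i, ∑ c, U i 0 * x' c * (y' c * U 0 i) = 1
    have e1 : ∀ i c, U i 0 * x' c * (y' c * U 0 i) = U i 0 * (x' c * y' c) * U 0 i := fun i c ↦ by
      rw [mul_assoc, mul_assoc, mul_assoc]
    simp_rw [e1, ← Finset.sum_mul, ← Finset.mul_sum, hsum', mul_one, hU, if_true]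
    exact hUsum
  have hadjxy : ∀ ic (v w : complexBetti X.X 1), polarizationPairingOne X.X D (X.dim - 1) (x ic v) w =
      polarizationPairingOne X.X D (X.dim - 1) v (y ic w) := by
    rintro ⟨i, c⟩ v w
    change polarizationPairingOne X.X D (X.dim - 1) ((U i 0 * x' c) v) w =
      polarizationPairingOne X.X D (X.dim - 1) v ((y' c * U 0 i) w)
    rw [Module.End.mul_apply, Module.End.mul_apply, hUadj, hadj']
  have hxmem : ∀ ic, x ic ∈ Algebra.adjoin ℂ (symmetricPullbackSpan X D : Set (Module.End ℂ (complexBetti X.X 1))) :=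
    fun ic ↦ Subalgebra.mul_mem _ (hUadjoin _ _) (hx' _)
  have hymem : ∀ ic, y ic ∈ Algebra.adjoin ℂ (symmetricPullbackSpan X D : Set (Module.End ℂ (complexBetti X.X 1))) :=
    fun ic ↦ Subalgebra.mul_mem _ (hy' _) (hUadjoin _ _)
  have hTx : ∀ ic, T * x ic = x ic * T := by
    rintro ⟨i, c⟩
    change T * (U i 0 * x' c) = U i 0 * x' c * T
    rw [← mul_assoc, hTU, mul_assoc, hTx', ← mul_assoc]
  have hTy : ∀ ic, T * y ic = y ic * T := by
    rintro ⟨i, c⟩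
    change T * (y' c * U 0 i) = y' c * U 0 i * T
    rw [← mul_assoc, hTy', mul_assoc, hTU, ← mul_assoc]
  -- the generators lie in `ℂ⟨T, x y⟩`
  have hW_unit : ∀ c d, U c d ∈ Submodule.span ℂ
      (Set.range fun st : (Fin (n + 1) × Fin 2) × (Fin (n + 1) × Fin 2) ↦ x st.1 * y st.2) := by
    intro c d
    have e1 : U c d = ∑ k, x (c, k) * y (d, k) := by
      change U c d = ∑ k, U c 0 * x' k * (y' k * U 0 d)
      have e2 : ∀ k, U c 0 * x' k * (y' k * U 0 d) = U c 0 * (x' k * y' k) * U 0 d := fun k ↦ by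
        rw [mul_assoc, mul_assoc, mul_assoc]
      simp_rw [e2, ← Finset.sum_mul, ← Finset.mul_sum, hsum', mul_one, hU, if_true]
    rw [e1]
    exact Submodule.sum_mem _ fun k _ ↦ Submodule.subset_span ⟨((c, k), (d, k)), rfl⟩
  have hW_pair : ∀ k l, x' k * y' l ∈ Submodule.span ℂ
      (Set.range fun st : (Fin (n + 1) × Fin 2) × (Fin (n + 1) × Fin 2) ↦ x st.1 * y st.2) := by
    intro k l
    have e1 : x' k * y' l = ∑ i, x (i, k) * y (i, l) := by
      change x' k * y' l = ∑ i, U i 0 * x' k * (y' l * U 0 i)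
      have e2 : ∀ i, U i 0 * x' k * (y' l * U 0 i) = x' k * y' l * (U i 0 * U 0 i) := fun i ↦ by
        rw [hUx', mul_assoc, mul_assoc, ← mul_assoc (U i 0), hUy', mul_assoc]
      simp_rw [e2, hU, if_true, ← Finset.mul_sum, hUsum, mul_one]
    rw [e1]
    exact Submodule.sum_mem _ fun i _ ↦ Submodule.subset_span ⟨((i, k), (i, l)), rfl⟩
  have hgens : insert T (insert Sa (insert Sb (Set.range fun ab : Fin (n + 1) × Fin (n + 1) ↦ U ab.1 ab.2))) ⊆
      (Algebra.adjoin ℂ (insert T (Set.range fun st : (Fin (n + 1) × Fin 2) × (Fin (n + 1) × Fin 2) ↦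
        x st.1 * y st.2)) : Set (Module.End ℂ (complexBetti X.X 1))) := by
    have hWR : Submodule.span ℂ (Set.range fun st : (Fin (n + 1) × Fin 2) × (Fin (n + 1) × Fin 2) ↦ x st.1 * y st.2) ≤
        Subalgebra.toSubmodule (Algebra.adjoin ℂ (insert T (Set.range
          fun st : (Fin (n + 1) × Fin 2) × (Fin (n + 1) × Fin 2) ↦ x st.1 * y st.2))) :=
      Submodule.span_le.2 fun g hg ↦ Algebra.subset_adjoin (Set.mem_insert_of_mem _ hg)
    have hSW : ({Sa, Sb} : Set (Module.End ℂ (complexBetti X.X 1))) ⊆ Submodule.span ℂ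
        (Set.range fun st : (Fin (n + 1) × Fin 2) × (Fin (n + 1) × Fin 2) ↦ x st.1 * y st.2) :=
      hST'.trans (Submodule.span_le.2 (by rintro _ ⟨kl, rfl⟩; exact hW_pair kl.1 kl.2))
    refine Set.insert_subset_iff.2 ⟨Algebra.subset_adjoin (Set.mem_insert _ _), Set.insert_subset_iff.2
      ⟨hWR (hSW (Set.mem_insert _ _)), Set.insert_subset_iff.2
        ⟨hWR (hSW (Set.mem_insert_of_mem _ (Set.mem_singleton _))), ?_⟩⟩⟩
    rintro _ ⟨ab, rfl⟩
    exact hWR (hW_unit ab.1 ab.2)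
  exact weilClassesField_le_divisorClassesSpan_of_moritaData_of_symmetric hPm hPe hPirr hφ herX hhX hndX hyx hsumxy
    hadjxy hxmem hymem hT_symm hTx hTy hsne hTnodal (Algebra.adjoin_le hgens hF)

/-- **… and consists of HODGE classes** (`W_F ⊗ ℂ ≤ ℬᵐ ⊗ ℂ`). [cite: MoonenZarhin1998WeilClasses, §1 Criterion (2) and the Remark after it («type 1, 2 or 3 ⟹ n_σ = n_σ′»; chunk p0002 L1–L12, p0003 L46–L58)]
[cite: vanGeemen1994HodgeAV, §2.4] -/
theorem weilClassesField_biproduct_le_hodgeClassSpan_of_mem_adjoin_quaternion_diagonal (hA : 0 < A.dim)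
    (hh : h ∈ hodgeClassSpan A.dim A.X 1) (htop : lefschetzPow h (A.dim - 1) 2 h ≠ 0)
    (hnd : ∀ x : complexBetti A.X 1, (∀ y, polarizationPairingOne A.X h (A.dim - 1) x y = 0) → x = 0)
    (hψsym : ∀ v w : complexBetti A.X 1, polarizationPairingOne A.X h (A.dim - 1) (pullbackOne A ψ v) w =
      polarizationPairingOne A.X h (A.dim - 1) v (pullbackOne A ψ w))
    (hQm : Q.Monic) (hQirr : Irreducible (Q.map (Int.castRingHom ℚ)))
    (hψQ : Polynomial.eval₂ (Int.castRingHom (CategoryTheory.End A)) (ψ : CategoryTheory.End A) Q = 0)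
    (ha : a ≠ 0) (hα2 : pullbackOne A α * pullbackOne A α = a • 1)
    (hb : b ≠ 0) (hβ2 : pullbackOne A β * pullbackOne A β = b • 1)
    (hanti : pullbackOne A α * pullbackOne A β = -(pullbackOne A β * pullbackOne A α))
    (hαsym : ∀ v w : complexBetti A.X 1, polarizationPairingOne A.X h (A.dim - 1) (pullbackOne A α v) w =
      polarizationPairingOne A.X h (A.dim - 1) v (pullbackOne A α w))
    (hβsym : ∀ v w : complexBetti A.X 1, polarizationPairingOne A.X h (A.dim - 1) (pullbackOne A β v) w =
      polarizationPairingOne A.X h (A.dim - 1) v (pullbackOne A β w))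
    (hψα : pullbackOne A ψ * pullbackOne A α = pullbackOne A α * pullbackOne A ψ)
    (hψβ : pullbackOne A ψ * pullbackOne A β = pullbackOne A β * pullbackOne A ψ)
    (hPm : P.Monic) (hPe : P.natDegree = e) (hPirr : Irreducible (P.map (Int.castRingHom ℚ)))
    (hφ : Polynomial.eval₂ (Int.castRingHom (CategoryTheory.End (⨁ (fun _ : Fin (n + 1) => A))))
      (φ : CategoryTheory.End (⨁ (fun _ : Fin (n + 1) => A))) P = 0)
    (her : e * (2 * m) = 2 * ((n + 1) * A.dim))
    (hF : pullbackOne (⨁ (fun _ : Fin (n + 1) => A)) φ ∈ Algebra.adjoin ℂ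
      (insert (pullbackOne (⨁ (fun _ : Fin (n + 1) => A)) (biproduct.map fun _ : Fin (n + 1) => ψ))
        (insert (pullbackOne (⨁ (fun _ : Fin (n + 1) => A)) (biproduct.map fun _ : Fin (n + 1) => α))
          (insert (pullbackOne (⨁ (fun _ : Fin (n + 1) => A)) (biproduct.map fun _ : Fin (n + 1) => β))
            (Set.range fun ab : Fin (n + 1) × Fin (n + 1) ↦ pullbackOne (⨁ (fun _ : Fin (n + 1) => A))
              (biproduct.π (fun _ : Fin (n + 1) => A) ab.1 ≫ biproduct.ι (fun _ : Fin (n + 1) => A) ab.2)))))) :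
    weilClassesField (⨁ (fun _ : Fin (n + 1) => A)) φ P (2 * m) ≤
      hodgeClassSpan (⨁ (fun _ : Fin (n + 1) => A)).dim (⨁ (fun _ : Fin (n + 1) => A)).X m :=
  (weilClassesField_biproduct_le_divisorClassesSpan_of_mem_adjoin_quaternion_diagonal hA hh htop hnd hψsym hQm
      hQirr hψQ ha hα2 hb hβ2 hanti hαsym hβsym hψα hψβ hPm hPe hPirr hφ her hF).trans
    (divisorClassesSpan_le_hodgeClassSpan_of_isSmoothProjective
      (AbelianVariety.isSmoothProjective_holds (A := (⨁ (fun _ : Fin (n + 1) => A)))) m)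

/-- **… and is ALGEBRAIC**: `W_F ⊗ ℂ ≤ algebraicClasses` — THE WEIL CLASSES OF EVERY SUBFIELD OF `M_{n+1}(ℚ(ψ)⟨α, β⟩)`
ON `A^{n+1}` ARE ALGEBRAIC, by the Lefschetz theorem on `(1,1)`-classes (the tree's `lefschetzOneOne_rational_holds`).
[cite: MoonenZarhin1998WeilClasses, Introduction (chunk p0001 L10–L18) and §1 Criterion (2) (chunk p0003 L46–L90)]
[cite: VoisinHodgeI2002, Thm. 11.30] -/
theorem weilClassesField_biproduct_le_algebraicClasses_of_mem_adjoin_quaternion_diagonal (hA : 0 < A.dim)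
    (hh : h ∈ hodgeClassSpan A.dim A.X 1) (htop : lefschetzPow h (A.dim - 1) 2 h ≠ 0)
    (hnd : ∀ x : complexBetti A.X 1, (∀ y, polarizationPairingOne A.X h (A.dim - 1) x y = 0) → x = 0)
    (hψsym : ∀ v w : complexBetti A.X 1, polarizationPairingOne A.X h (A.dim - 1) (pullbackOne A ψ v) w =
      polarizationPairingOne A.X h (A.dim - 1) v (pullbackOne A ψ w))
    (hQm : Q.Monic) (hQirr : Irreducible (Q.map (Int.castRingHom ℚ)))
    (hψQ : Polynomial.eval₂ (Int.castRingHom (CategoryTheory.End A)) (ψ : CategoryTheory.End A) Q = 0)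
    (ha : a ≠ 0) (hα2 : pullbackOne A α * pullbackOne A α = a • 1)
    (hb : b ≠ 0) (hβ2 : pullbackOne A β * pullbackOne A β = b • 1)
    (hanti : pullbackOne A α * pullbackOne A β = -(pullbackOne A β * pullbackOne A α))
    (hαsym : ∀ v w : complexBetti A.X 1, polarizationPairingOne A.X h (A.dim - 1) (pullbackOne A α v) w =
      polarizationPairingOne A.X h (A.dim - 1) v (pullbackOne A α w))
    (hβsym : ∀ v w : complexBetti A.X 1, polarizationPairingOne A.X h (A.dim - 1) (pullbackOne A β v) w =
      polarizationPairingOne A.X h (A.dim - 1) v (pullbackOne A β w))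
    (hψα : pullbackOne A ψ * pullbackOne A α = pullbackOne A α * pullbackOne A ψ)
    (hψβ : pullbackOne A ψ * pullbackOne A β = pullbackOne A β * pullbackOne A ψ)
    (hPm : P.Monic) (hPe : P.natDegree = e) (hPirr : Irreducible (P.map (Int.castRingHom ℚ)))
    (hφ : Polynomial.eval₂ (Int.castRingHom (CategoryTheory.End (⨁ (fun _ : Fin (n + 1) => A))))
      (φ : CategoryTheory.End (⨁ (fun _ : Fin (n + 1) => A))) P = 0)
    (her : e * (2 * m) = 2 * ((n + 1) * A.dim))
    (hF : pullbackOne (⨁ (fun _ : Fin (n + 1) => A)) φ ∈ Algebra.adjoin ℂ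
      (insert (pullbackOne (⨁ (fun _ : Fin (n + 1) => A)) (biproduct.map fun _ : Fin (n + 1) => ψ))
        (insert (pullbackOne (⨁ (fun _ : Fin (n + 1) => A)) (biproduct.map fun _ : Fin (n + 1) => α))
          (insert (pullbackOne (⨁ (fun _ : Fin (n + 1) => A)) (biproduct.map fun _ : Fin (n + 1) => β))
            (Set.range fun ab : Fin (n + 1) × Fin (n + 1) ↦ pullbackOne (⨁ (fun _ : Fin (n + 1) => A))
              (biproduct.π (fun _ : Fin (n + 1) => A) ab.1 ≫ biproduct.ι (fun _ : Fin (n + 1) => A) ab.2)))))) :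
    weilClassesField (⨁ (fun _ : Fin (n + 1) => A)) φ P (2 * m) ≤ algebraicClasses (⨁ (fun _ : Fin (n + 1) => A)).X m :=
  (weilClassesField_biproduct_le_divisorClassesSpan_of_mem_adjoin_quaternion_diagonal hA hh htop hnd hψsym hQm
      hQirr hψQ ha hα2 hb hβ2 hanti hαsym hβsym hψα hψβ hPm hPe hPirr hφ her hF).trans
    (AbelianVariety.divisorClassesSpan_le_algebraicClasses (⨁ (fun _ : Fin (n + 1) => A))
      (fun c hc hc' ↦ lefschetzOneOne_rational_holds
        (AbelianVariety.isSmoothProjective_holds (A := (⨁ (fun _ : Fin (n + 1) => A)))) c hc hc') m)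

/-- Element form: every class of `W_F ⊗ ℂ` — in particular every rational Weil class of a subfield of
`M_{n+1}(ℚ(ψ)⟨α, β⟩)` on `A^{n+1}` — is a `ℂ`-combination of algebraic classes. [cite: MoonenZarhin1998WeilClasses, Introduction (chunk p0001 L10–L18) and §1 Criterion (2) (chunk p0003 L46–L90)] -/
theorem mem_algebraicClasses_of_mem_weilClassesField_biproduct_of_mem_adjoin_quaternion_diagonal (hA : 0 < A.dim)
    (hh : h ∈ hodgeClassSpan A.dim A.X 1) (htop : lefschetzPow h (A.dim - 1) 2 h ≠ 0)
    (hnd : ∀ x : complexBetti A.X 1, (∀ y, polarizationPairingOne A.X h (A.dim - 1) x y = 0) → x = 0)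
    (hψsym : ∀ v w : complexBetti A.X 1, polarizationPairingOne A.X h (A.dim - 1) (pullbackOne A ψ v) w =
      polarizationPairingOne A.X h (A.dim - 1) v (pullbackOne A ψ w))
    (hQm : Q.Monic) (hQirr : Irreducible (Q.map (Int.castRingHom ℚ)))
    (hψQ : Polynomial.eval₂ (Int.castRingHom (CategoryTheory.End A)) (ψ : CategoryTheory.End A) Q = 0)
    (ha : a ≠ 0) (hα2 : pullbackOne A α * pullbackOne A α = a • 1)
    (hb : b ≠ 0) (hβ2 : pullbackOne A β * pullbackOne A β = b • 1)
    (hanti : pullbackOne A α * pullbackOne A β = -(pullbackOne A β * pullbackOne A α))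
    (hαsym : ∀ v w : complexBetti A.X 1, polarizationPairingOne A.X h (A.dim - 1) (pullbackOne A α v) w =
      polarizationPairingOne A.X h (A.dim - 1) v (pullbackOne A α w))
    (hβsym : ∀ v w : complexBetti A.X 1, polarizationPairingOne A.X h (A.dim - 1) (pullbackOne A β v) w =
      polarizationPairingOne A.X h (A.dim - 1) v (pullbackOne A β w))
    (hψα : pullbackOne A ψ * pullbackOne A α = pullbackOne A α * pullbackOne A ψ)
    (hψβ : pullbackOne A ψ * pullbackOne A β = pullbackOne A β * pullbackOne A ψ)
    (hPm : P.Monic) (hPe : P.natDegree = e) (hPirr : Irreducible (P.map (Int.castRingHom ℚ)))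
    (hφ : Polynomial.eval₂ (Int.castRingHom (CategoryTheory.End (⨁ (fun _ : Fin (n + 1) => A))))
      (φ : CategoryTheory.End (⨁ (fun _ : Fin (n + 1) => A))) P = 0)
    (her : e * (2 * m) = 2 * ((n + 1) * A.dim))
    (hF : pullbackOne (⨁ (fun _ : Fin (n + 1) => A)) φ ∈ Algebra.adjoin ℂ
      (insert (pullbackOne (⨁ (fun _ : Fin (n + 1) => A)) (biproduct.map fun _ : Fin (n + 1) => ψ))
        (insert (pullbackOne (⨁ (fun _ : Fin (n + 1) => A)) (biproduct.map fun _ : Fin (n + 1) => α))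
          (insert (pullbackOne (⨁ (fun _ : Fin (n + 1) => A)) (biproduct.map fun _ : Fin (n + 1) => β))
            (Set.range fun ab : Fin (n + 1) × Fin (n + 1) ↦ pullbackOne (⨁ (fun _ : Fin (n + 1) => A))
              (biproduct.π (fun _ : Fin (n + 1) => A) ab.1 ≫ biproduct.ι (fun _ : Fin (n + 1) => A) ab.2))))))
    {c : complexBetti (⨁ (fun _ : Fin (n + 1) => A)).X (2 * m)}
    (hc : c ∈ weilClassesField (⨁ (fun _ : Fin (n + 1) => A)) φ P (2 * m)) :
    c ∈ algebraicClasses (⨁ (fun _ : Fin (n + 1) => A)).X m :=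
  weilClassesField_biproduct_le_algebraicClasses_of_mem_adjoin_quaternion_diagonal hA hh htop hnd hψsym hQm hQirr
    hψQ ha hα2 hb hβ2 hanti hαsym hβsym hψα hψβ hPm hPe hPirr hφ her hF hc

end QuaternionMatrices

end Literature.AlgebraicGeometry.HodgeTheory

end
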